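import Summits.QuantumAdvantage.QuantumAdvantage.Theorems.GaussRankPolyImpliesPPoly.Negative.MajoranaCAR

/-!
# Negative lemmas III-c: the quadratic (Cartan–Plücker) relations of a Gaussian state from the annihilator definition

Disprover's support file for crux `SpinorFlattening.GaussRankPolyImpliesPPoly` (stmt-QuantumAdvantage-1247),
refuter-cdisprove-stmt-QuantumAdvantage-1247-g2-0 (gen 2, 2026-08-16); work file `Cruxes/GaussRankPolyImpliesPPoly/Disproof.lean`.
Part of the in-tree proof of the Gaussian fidelity bound `F_𝒢(M^{⊗t}) ≤ 2^{-t}` (CudbyStrelchuk2023 Lemma 3)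
from the annihilator definition `IsGaussian` (files MajoranaAction → MajoranaCAR → QuadraticRelations →
CornerLemma → GaussianFidelity). Sorry-free; nothing here asserts a Theses statement.

THIS FILE: `annihilator_rows_isotropic` (the rows `A k` of `IsGaussian` are isotropic for the bilinear dot
product), `mem_span_of_dotProduct_annihilators_eq_zero` (an `n`-dimensional isotropic row space in `ℂ^{2n}` is
its own orthogonal — rank–nullity), and `isGaussian_quadRel`: `Σ_p (c_p G)(u) · (c_p G)(v) = 0` for every
Gaussian `G` and all labels `u, v` (`Λ(G ⊗ G) = 0`, `Λ = Σ_p c_p ⊗ c_p`).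
-/

set_option linter.dupNamespace false

noncomputable section

namespace Summit.QuantumAdvantage.QuantumAdvantage.Theorems.GaussRankPolyImpliesPPoly.Negative

open Literature.Computability.Cryptography Literature.Computability.QuantumComplexity
open Matrix

/-- **The annihilator rows of a Gaussian state are ISOTROPIC** for the bilinear dot product:
`A k ⬝ᵥ A k' = 0` (both `c(A k)` and `c(A k')` kill `G ≠ 0`, and `c(u)c(v) + c(v)c(u) = 2(u ⬝ᵥ v)·1`).
[cite: DiasKoenig2024, §2.3] -/
theorem annihilator_rows_isotropic {n : ℕ} {G : QReg n → ℂ} (hG0 : G ≠ 0)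
    (A : Fin n → (Fin n × Bool → ℂ))
    (hann : ∀ k, (∑ p : Fin n × Bool, A k p • majorana n p.1 p.2) *ᵥ G = 0) (k k' : Fin n) :
    A k ⬝ᵥ A k' = 0 := by
  have h := congrArg (fun M => M *ᵥ G) (majoranaComb_anticomm (A k) (A k'))
  simp only [add_mulVec, ← mulVec_mulVec, hann, mulVec_zero, zero_add, smul_mulVec, one_mulVec] at h
  -- h : 0 = (2 * (A k ⬝ᵥ A k')) • G
  obtain ⟨x, hx⟩ : ∃ x, G x ≠ 0 := by
    by_contra hno
    push Not at hno
    exact hG0 (funext hno)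
  have hx' := congrFun h x
  simp only [Pi.zero_apply, Pi.smul_apply, smul_eq_mul] at hx'
  have : 2 * (A k ⬝ᵥ A k') = 0 := by
    rcases mul_eq_zero.1 hx'.symm with h2 | h2
    · exact h2
    · exact absurd h2 hx
  simpa using this

/-- **A maximal isotropic (annihilator) row space is its own orthogonal**: if the `n` rows `A k` of
`ℂ^{2n}` are linearly independent and pairwise isotropic, then every `y` with `A k ⬝ᵥ y = 0` for all `k`
lies in their span (`L ⊆ L^⊥` and `dim L^⊥ = 2n − n = n = dim L`). [cite: DiasKoenig2024, §2.3] -/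
theorem mem_span_of_dotProduct_annihilators_eq_zero {n : ℕ} (A : Fin n → (Fin n × Bool → ℂ))
    (hA : LinearIndependent ℂ A) (hiso : ∀ k k', A k ⬝ᵥ A k' = 0)
    (y : Fin n × Bool → ℂ) (hy : ∀ k, A k ⬝ᵥ y = 0) :
    y ∈ Submodule.span ℂ (Set.range A) := by
  classical
  let M : Matrix (Fin n) (Fin n × Bool) ℂ := Matrix.of A
  let K : Submodule ℂ (Fin n × Bool → ℂ) := LinearMap.ker M.mulVecLin
  have hK : ∀ z, z ∈ K ↔ ∀ k, A k ⬝ᵥ z = 0 := by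
    intro z
    rw [LinearMap.mem_ker, Matrix.mulVecLin_apply]
    constructor
    · intro h k
      have := congrFun h k
      simpa [Matrix.mulVec, M] using this
    · intro h
      funext k
      simpa [Matrix.mulVec, M] using h k
  let W : Submodule ℂ (Fin n × Bool → ℂ) := Submodule.span ℂ (Set.range A)
  have hWK : W ≤ K := by
    rw [Submodule.span_le]
    rintro _ ⟨k', rfl⟩
    exact (hK _).2 fun k => hiso k k'
  have hW : Module.finrank ℂ W = n := by
    rw [finrank_span_eq_card hA, Fintype.card_fin]
  have hrank : M.rank = n := by
    have : LinearIndependent ℂ M.row := hA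
    rw [this.rank_matrix, Fintype.card_fin]
  have hKdim : Module.finrank ℂ K = n := by
    have h := LinearMap.finrank_range_add_finrank_ker M.mulVecLin
    rw [Module.finrank_fintype_fun_eq_card, Fintype.card_prod, Fintype.card_fin, Fintype.card_bool] at h
    have hr : Module.finrank ℂ (LinearMap.range M.mulVecLin) = n := hrank
    rw [hr] at h
    change n + Module.finrank ℂ K = n * 2 at h
    omega
  have hEq : W = K := Submodule.eq_of_le_of_finrank_eq hWK (by rw [hW, hKdim])
  have : y ∈ K := (hK y).2 hy
  rwa [← hEq] at this

/-- **QUADRATIC RELATIONS OF A GAUSSIAN STATE** (`Λ(G ⊗ G) = 0`, `Λ = Σ_p c_p ⊗ c_p`; Cartan's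
pure-spinor relations, the Plücker-type equations of the spinor variety): for every Gaussian `G` and all
basis labels `u, v`,  `Σ_p (c_p G)(u) · (c_p G)(v) = 0`.
Proof from the annihilator definition alone: the vector `y_p := (c_p G)(v)` satisfies
`A k ⬝ᵥ y = (c(A k) G)(v) = 0` for every annihilator row, hence lies in their span (the row space is
its own orthogonal), and the functional `z ↦ Σ_p (c_p G)(u) z_p` kills every annihilator row for the same
reason. [cite: Bravyi2005, Thm. 1 (Λ-characterisation of Gaussian states)] -/
theorem isGaussian_quadRel {n : ℕ} {G : QReg n → ℂ} (hG : IsGaussian G) (u v : QReg n) :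
    ∑ p : Fin n × Bool, (majorana n p.1 p.2 *ᵥ G) u * (majorana n p.1 p.2 *ᵥ G) v = 0 := by
  obtain ⟨hG0, A, hA, hann⟩ := hG
  set x : Fin n × Bool → ℂ := fun p => (majorana n p.1 p.2 *ᵥ G) u with hx
  set y : Fin n × Bool → ℂ := fun p => (majorana n p.1 p.2 *ᵥ G) v with hy
  change x ⬝ᵥ y = 0
  have hAy : ∀ k, A k ⬝ᵥ y = 0 := fun k => by
    rw [hy, ← majoranaComb_mulVec_apply, hann k, Pi.zero_apply]
  have hAx : ∀ k, A k ⬝ᵥ x = 0 := fun k => by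
    rw [hx, ← majoranaComb_mulVec_apply, hann k, Pi.zero_apply]
  have hiso := annihilator_rows_isotropic hG0 A hann
  have hmem := mem_span_of_dotProduct_annihilators_eq_zero A hA hiso y hAy
  -- the functional `z ↦ x ⬝ᵥ z` vanishes on the span of the rows
  refine Submodule.span_induction (p := fun z _ => x ⬝ᵥ z = 0) ?_ ?_ ?_ ?_ hmem
  · rintro _ ⟨k, rfl⟩
    rw [dotProduct_comm]
    exact hAx k
  · exact dotProduct_zero _
  · intro z z' _ _ hz hz'
    rw [dotProduct_add, hz, hz', add_zero]
  · intro c z _ hz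
    rw [dotProduct_smul, hz, smul_zero]

end Summit.QuantumAdvantage.QuantumAdvantage.Theorems.GaussRankPolyImpliesPPoly.Negative
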